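import Literature.Computability.AlgebraicComplexity.LaserFormatPooling
import Summits.MatrixMultiplication.MatrixMultiplication.Theorems.SaturationLadderPooledDesign
import Summits.MatrixMultiplication.MatrixMultiplication.Theorems.SaturationLadderLevelOne

/-!
# Pooled level-1 designs — II: `CW_6 ⊗ CW_7` and `α ≥ 27/92` (route `SaturationLadder`, lens 1, gen 20)

Cell `decomp-mm`, lens 1 («grading / quantitative ladder»), gen 20, part 5b.  No definitions, no
named facts, no sorry.  The tree's `α`-ladder before this file: `α ≥ 77/267 = 0.28839`
(`alpha_ge_77_267`, the level-1 content of a SINGLE `CW_q`, maximal at `q = 6`).  Coppersmith's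
1997 mechanism — run the laser method on `CW_6 ⊗ CW_7` with a JOINT type, so that the marginal
entropy budgets of the two factors are POOLED (the `q = 6` factor over-draws on the `Y/Z`
marginals, the `q = 7` factor donates) — is the pooling theorem
`laserMethod_hasFormatValue_pair_of_mul` (`Literature/…/LaserFormatPooling.lean`).  Here it is
instantiated with the exact rational designs
* `q = 6`: counts `(114, 36, 114, 38, 1, 1)/304` (`X = (38,228,38)/304` natural,
  `Y = Z = (153,150,1)/304`),
* `q = 7`: counts `(553, 152, 553, 158, 3, 3)/1422` (`X = (158,1106,158)/1422` natural,
  `Y = Z = (714,705,3)/1422`),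
giving independent products of format `(A, B, A)`, `A = 6^{3/8} 7^{7/18}`,
`B = 6^{36/304} 7^{152/1422}`, counted by `2^{min_m (H_m + H'_m)}` with
`2^{H_m + H'_m} A² ≥ 72 ≥ R̃(CW_6 ⊗ CW_7)` for all three marginals (§2: four integer entropy
certificates, the transfer inequality `6^{13} ≤ 7^{12}`), and `A^{27/92} ≤ B` (`7^{23} ≤ 6^{25}`);
the reading lemma `mul_rpow_omegaRect_le_asymptoticRank_of_hasFormatValue` then gives
`ω(1, 27/92, 1) = 2`, i.e. **`α ≥ 27/92 = 0.29347…`** (`alpha_ge_27_92`; Coppersmith 1997 states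
`α > 0.29462` from the real optimum of the same programme, `0.29461…` in our normalisation).

References: D. Coppersmith, *Rectangular matrix multiplication revisited*, J. Complexity 13
(1997) 42–49, §3 [Coppersmith1997]; Coppersmith–Winograd 1990 §6 [CoppersmithWinograd1990];
Le Gall 2012 §1, Thm 2.1 [LeGall2012]; Le Gall 2014 §5 [LeGall2014].
-/

set_option linter.dupNamespace false
-- (single-conjunct summit: the namespace repeats `MatrixMultiplication`)

noncomputable section

open Finset
open scoped BigOperators

namespace Summit.MatrixMultiplication.MatrixMultiplication.Theorems.SaturationLadderPooled

open Literature.Computability.AlgebraicComplexity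
open Literature.Barriers.MatrixMultiplication
open Summit.MatrixMultiplication.MatrixMultiplication.Theorems.SaturationLadderLevelOne

/-! ## §1 A six-pattern design as laser data; scaled entropy certificates -/

/-- **A level-1 design as laser data.**  Positive counts `(n₁,…,n₆)` with total `N₀` give a law
`P = c/N₀` on the six patterns of `CW_q` (vanishing elsewhere), of product form, with
`P(1,1,0) = n₁/N₀`, `P(0,1,1) = n₂/N₀`, `P(1,0,1) = n₃/N₀` and marginal entropies those of
`X = (n₂+n₅+n₆, n₁+n₃, n₄)`, `Y = (n₃+n₄+n₆, n₁+n₂, n₅)`, `Z = (n₁+n₄+n₅, n₂+n₃, n₆)` over `N₀`.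
[cite: CoppersmithWinograd1990, §6] -/
theorem six_design (n₁ n₂ n₃ n₄ n₅ n₆ N₀ : ℕ) (hN : n₁ + n₂ + n₃ + n₄ + n₅ + n₆ = N₀)
    (h₁ : 0 < n₁) (h₂ : 0 < n₂) (h₃ : 0 < n₃) (h₄ : 0 < n₄) (h₅ : 0 < n₅) (h₆ : 0 < n₆) :
    ∃ (P : Fin 3 × Fin 3 × Fin 3 → ℝ) (c : Fin 3 × Fin 3 × Fin 3 → ℕ) (f g h : Fin 3 → ℝ),
      (∀ s, s ∉ cwSupport₃ → c s = 0) ∧ (∑ s, c s = N₀) ∧ (∀ s, P s = (c s : ℝ) / N₀) ∧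
      (∀ x ∈ cwSupport₃, 0 < f x.1) ∧ (∀ x ∈ cwSupport₃, 0 < g x.2.1) ∧
      (∀ x ∈ cwSupport₃, 0 < h x.2.2) ∧ (∀ x ∈ cwSupport₃, P x = f x.1 * g x.2.1 * h x.2.2) ∧
      P (1, 1, 0) = (n₁ : ℝ) / N₀ ∧ P (0, 1, 1) = (n₂ : ℝ) / N₀ ∧ P (1, 0, 1) = (n₃ : ℝ) / N₀ ∧
      shannonEntropy (marginalDist₁ P) =
        shannonEntropy ![((n₂ + n₅ + n₆ : ℕ) : ℝ) / N₀, ((n₁ + n₃ : ℕ) : ℝ) / N₀, (n₄ : ℝ) / N₀] ∧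
      shannonEntropy (marginalDist₂ P) =
        shannonEntropy ![((n₃ + n₄ + n₆ : ℕ) : ℝ) / N₀, ((n₁ + n₂ : ℕ) : ℝ) / N₀, (n₅ : ℝ) / N₀] ∧
      shannonEntropy (marginalDist₃ P) =
        shannonEntropy ![((n₁ + n₄ + n₅ : ℕ) : ℝ) / N₀, ((n₂ + n₃ : ℕ) : ℝ) / N₀, (n₆ : ℝ) / N₀] := by
  have hN0 : (0 : ℝ) < N₀ := by exact_mod_cast (show 0 < N₀ by omega)
  set P : Fin 3 × Fin 3 × Fin 3 → ℝ := fun s => if s = (1, 1, 0) then (n₁ : ℝ) / N₀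
    else if s = (0, 1, 1) then (n₂ : ℝ) / N₀ else if s = (1, 0, 1) then (n₃ : ℝ) / N₀
    else if s = (2, 0, 0) then (n₄ : ℝ) / N₀ else if s = (0, 2, 0) then (n₅ : ℝ) / N₀
    else if s = (0, 0, 2) then (n₆ : ℝ) / N₀ else 0 with hPdef
  set c : Fin 3 × Fin 3 × Fin 3 → ℕ := fun s => if s = (1, 1, 0) then n₁
    else if s = (0, 1, 1) then n₂ else if s = (1, 0, 1) then n₃ else if s = (2, 0, 0) then n₄
    else if s = (0, 2, 0) then n₅ else if s = (0, 0, 2) then n₆ else 0 with hcdef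
  have hP : ∀ s, P s = if s = (1, 1, 0) then (n₁ : ℝ) / N₀
      else if s = (0, 1, 1) then (n₂ : ℝ) / N₀ else if s = (1, 0, 1) then (n₃ : ℝ) / N₀
      else if s = (2, 0, 0) then (n₄ : ℝ) / N₀ else if s = (0, 2, 0) then (n₅ : ℝ) / N₀
      else if s = (0, 0, 2) then (n₆ : ℝ) / N₀ else 0 := fun s => rfl
  have hc : ∀ s, c s = if s = (1, 1, 0) then n₁
      else if s = (0, 1, 1) then n₂ else if s = (1, 0, 1) then n₃ else if s = (2, 0, 0) then n₄
      else if s = (0, 2, 0) then n₅ else if s = (0, 0, 2) then n₆ else 0 := fun s => rfl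
  obtain ⟨hcS, hcsum, hPc⟩ := six_counts_law hN hP c hc
  obtain ⟨f, g, h, hf, hg, hh, hprod⟩ := six_productForm hP (div_pos (Nat.cast_pos.2 h₁) hN0)
    (div_pos (Nat.cast_pos.2 h₂) hN0) (div_pos (Nat.cast_pos.2 h₃) hN0)
    (div_pos (Nat.cast_pos.2 h₄) hN0) (div_pos (Nat.cast_pos.2 h₅) hN0)
    (div_pos (Nat.cast_pos.2 h₆) hN0)
  obtain ⟨e₁, e₂, e₃⟩ := shannonEntropy_marginals_six_counts hP
  refine ⟨P, c, f, g, h, hcS, hcsum, hPc, hf, hg, hh, hprod, ?_, ?_, ?_, e₁, e₂, e₃⟩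
  · rw [hP]; simp
  · rw [hP]; simp
  · rw [hP]; simp

/-- **Scaled integer entropy certificate**: for `u₀+u₁+u₂ = N₀` and a multiplier `M ≥ 1`,
`(q+2)^{MN₀} Π (Muᵢ)^{Muᵢ} ≤ (MN₀)^{MN₀} q^x` gives `log(q+2) − x log q/(MN₀) ≤ log 2 · H(u/N₀)`
(`entropyCert_of_nat` for the `M`-fold counts; the entropy is scale invariant). [folklore] -/
theorem entropyCert_scaled {q N₀ u₀ u₁ u₂ x : ℕ} (M : ℕ) (hq : 1 ≤ q) (hN : 1 ≤ N₀) (hM : 1 ≤ M)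
    (hu : u₀ + u₁ + u₂ = N₀)
    (h : (q + 2) ^ (M * N₀) * ((M * u₀) ^ (M * u₀) * (M * u₁) ^ (M * u₁) * (M * u₂) ^ (M * u₂)) ≤
      (M * N₀) ^ (M * N₀) * q ^ x) :
    Real.log ((q : ℝ) + 2) - (x : ℝ) * Real.log q / ((M * N₀ : ℕ) : ℝ) ≤
      Real.log 2 * shannonEntropy ![(u₀ : ℝ) / N₀, (u₁ : ℝ) / N₀, (u₂ : ℝ) / N₀] := by
  have hM0 : (M : ℝ) ≠ 0 := by exact_mod_cast (show M ≠ 0 by omega)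
  have key := entropyCert_of_nat (q := q) (N₀ := M * N₀) (u₀ := M * u₀) (u₁ := M * u₁)
    (u₂ := M * u₂) (x := x) hq (Nat.mul_pos (by omega) (by omega)) (by rw [← hu]; ring) h
  have e : ∀ u : ℕ, ((M * u : ℕ) : ℝ) / ((M * N₀ : ℕ) : ℝ) = (u : ℝ) / N₀ := fun u => by
    push_cast
    exact mul_div_mul_left _ _ hM0
  simp only [e] at key
  exact key

/-- `13 log 6 ≤ 12 log 7` (`6^{13} ≤ 7^{12}`): the transfer rate between the two factors'
entropy budgets. [folklore] -/
theorem log_six_thirteen_le : 13 * Real.log 6 ≤ 12 * Real.log 7 := by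
  have h : (6 : ℝ) ^ 13 ≤ (7 : ℝ) ^ 12 := by norm_num
  have := Real.log_le_log (by positivity) h
  rwa [Real.log_pow, Real.log_pow, Nat.cast_ofNat, Nat.cast_ofNat] at this

/-- `23 log 7 ≤ 25 log 6` (`7^{23} ≤ 6^{25}`): used for `A^{27/92} ≤ B`. [folklore] -/
theorem log_seven_twentythree_le : 23 * Real.log 7 ≤ 25 * Real.log 6 := by
  have h : (7 : ℝ) ^ 23 ≤ (6 : ℝ) ^ 25 := by norm_num
  have := Real.log_le_log (by positivity) h
  rwa [Real.log_pow, Real.log_pow, Nat.cast_ofNat, Nat.cast_ofNat] at this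

/-! ## §2 `CW_6 ⊗ CW_7` pooled: `ω(1, 27/92, 1) = 2` -/

set_option exponentiation.threshold 16384 in
set_option maxRecDepth 16384 in
set_option maxHeartbeats 4000000 in
/-- **`ω(1, 27/92, 1) ≤ 2` from `CW_6 ⊗ CW_7` with pooled marginal budgets** (Coppersmith 1997's
mechanism, exact designs `(114,36,114,38,1,1)/304` and `(553,152,553,158,3,3)/1422`;
certificates `Y/Z`: `q = 6` with multiplier `15`, `x = 3478`; `q = 7` with multiplier `5`,
`x = 5446`; `X`: natural, `x = 228`, `1106`). [cite: Coppersmith1997, §3]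
[cite: CoppersmithWinograd1990, §6] [cite: LeGall2012, Thm. 2.1] -/
theorem omegaRect_one_27_92_one_le_two : omegaRect ℂ 1 ((27 : ℝ) / 92) 1 ≤ 2 := by
  -- the two level-1 designs
  obtain ⟨P, c, f, g, h, hcS, hcsum, hP, hf, hg, hh, hprod, hP110, hP011, hP101, hH1, hH2, hH3⟩ :=
    six_design 114 36 114 38 1 1 304 (by norm_num) (by norm_num) (by norm_num) (by norm_num)
      (by norm_num) (by norm_num) (by norm_num)
  obtain ⟨P', c', f', g', h', hcS', hcsum', hP', hf', hg', hh', hprod', hP'110, hP'011, hP'101,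
      hH1', hH2', hH3'⟩ :=
    six_design 553 152 553 158 3 3 1422 (by norm_num) (by norm_num) (by norm_num) (by norm_num)
      (by norm_num) (by norm_num) (by norm_num)
  -- the pooled format value of `CW_6 ⊗ CW_7`
  have key := laserMethod_hasFormatValue_pair_of_mul (bigCwTensor ℂ 6) cwLevel₃ cwLevel₃ cwLevel₃
    cwSupport₃ (fun _ _ _ hx => cwLevel₃_mem_support ℂ hx) cwTight cwTight cwTightγ
    cwTight_injective cwTight_injective cwTightγ_injective cwTight_bound cwTight_bound cwTight_sum
    (fun _ => (1 : ℝ)) (fun s => ((6 : ℕ) : ℝ) ^ (s.1.val * s.2.1.val))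
    (fun s => ((6 : ℕ) : ℝ) ^ (s.2.1.val * s.2.2.val)) (fun s => ((6 : ℕ) : ℝ) ^ (s.1.val * s.2.2.val))
    (fun _ _ => one_pos) (fun s _ => format_six_pos 6 (by norm_num) _ _)
    (fun s _ => format_six_pos 6 (by norm_num) _ _) (fun s _ => format_six_pos 6 (by norm_num) _ _)
    (fun s hs => hasFormatValue_cwComp_six ℂ 6 s hs) c hcS (by norm_num : 0 < 304) hcsum P hP
    f g h hf hg hh hprod
    (bigCwTensor ℂ 7) cwLevel₃ cwLevel₃ cwLevel₃
    cwSupport₃ (fun _ _ _ hx => cwLevel₃_mem_support ℂ hx) cwTight cwTight cwTightγ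
    cwTight_injective cwTight_injective cwTightγ_injective cwTight_bound cwTight_bound cwTight_sum
    (fun _ => (1 : ℝ)) (fun s => ((7 : ℕ) : ℝ) ^ (s.1.val * s.2.1.val))
    (fun s => ((7 : ℕ) : ℝ) ^ (s.2.1.val * s.2.2.val)) (fun s => ((7 : ℕ) : ℝ) ^ (s.1.val * s.2.2.val))
    (fun _ _ => one_pos) (fun s _ => format_six_pos 7 (by norm_num) _ _)
    (fun s _ => format_six_pos 7 (by norm_num) _ _) (fun s _ => format_six_pos 7 (by norm_num) _ _)
    (fun s hs => hasFormatValue_cwComp_six ℂ 7 s hs) c' hcS' (by norm_num : 0 < 1422) hcsum' P' hP'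
    f' g' h' hf' hg' hh' hprod'
  rw [prod_six_one, prod_six_one, mul_one, mul_one, prod_six_formatA 6 P, prod_six_formatA 7 P',
    prod_six_formatB 6 P, prod_six_formatB 7 P', prod_six_formatC 6 P, prod_six_formatC 7 P',
    hP110, hP011, hP101, hP'110, hP'011, hP'101] at key
  push_cast at key
  set m : ℝ := min (shannonEntropy (marginalDist₁ P) + shannonEntropy (marginalDist₁ P'))
      (min (shannonEntropy (marginalDist₂ P) + shannonEntropy (marginalDist₂ P'))
        (shannonEntropy (marginalDist₃ P) + shannonEntropy (marginalDist₃ P'))) with hmdef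
  -- the numbers
  set A : ℝ := (6 : ℝ) ^ ((114 : ℝ) / 304) * (7 : ℝ) ^ ((553 : ℝ) / 1422) with hAdef
  set B : ℝ := (6 : ℝ) ^ ((36 : ℝ) / 304) * (7 : ℝ) ^ ((152 : ℝ) / 1422) with hBdef
  have hL6 : 0 < Real.log 6 := Real.log_pos (by norm_num)
  have hL7 : 0 < Real.log 7 := Real.log_pos (by norm_num)
  have hA1 : 1 < A := one_lt_mul_of_lt_of_le (Real.one_lt_rpow (by norm_num) (by norm_num))
    (Real.one_le_rpow (by norm_num) (by norm_num))
  have hA0 : 0 < A := by linarith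
  have hB0 : 0 < B := by positivity
  have hLA : Real.log A = 114 / 304 * Real.log 6 + 553 / 1422 * Real.log 7 := by
    rw [hAdef, Real.log_mul (Real.rpow_pos_of_pos (by norm_num) _).ne'
      (Real.rpow_pos_of_pos (by norm_num) _).ne', Real.log_rpow (by norm_num),
      Real.log_rpow (by norm_num)]
  have hLB : Real.log B = 36 / 304 * Real.log 6 + 152 / 1422 * Real.log 7 := by
    rw [hBdef, Real.log_mul (Real.rpow_pos_of_pos (by norm_num) _).ne'
      (Real.rpow_pos_of_pos (by norm_num) _).ne', Real.log_rpow (by norm_num),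
      Real.log_rpow (by norm_num)]
  have hlogA : 0 < Real.log A := Real.log_pos hA1
  have hAB : A ^ ((27 : ℝ) / 92) ≤ B := by
    rw [← Real.log_le_log_iff (Real.rpow_pos_of_pos hA0 _) hB0, Real.log_rpow hA0, hLA, hLB]
    linarith [log_seven_twentythree_le]
  -- reading: `2^m A^{ω(1,27/92,1)} ≤ R̃(CW_6 ⊗ CW_7) ≤ 72`
  have main := mul_rpow_omegaRect_le_asymptoticRank_of_hasFormatValue key hA1
    (by norm_num : (0 : ℝ) ≤ 27 / 92) hAB
  have h6 : asymptoticRank (bigCwTensor ℂ 6) ≤ 8 := by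
    have := asymptoticRank_bigCwTensor_le ℂ 6; norm_num at this; exact this
  have h7 : asymptoticRank (bigCwTensor ℂ 7) ≤ 9 := by
    have := asymptoticRank_bigCwTensor_le ℂ 7; norm_num at this; exact this
  have hR : asymptoticRank (kroneckerTensor (bigCwTensor ℂ 6) (bigCwTensor ℂ 7)) ≤ 8 * 9 :=
    (asymptoticRank_kronecker_le _ _).trans
      (mul_le_mul h6 h7 (asymptoticRank_nonneg _) (by norm_num))
  have hlog := Real.log_le_log (by positivity) (main.trans hR)
  rw [Real.log_mul (by positivity) (by positivity), Real.log_rpow two_pos, Real.log_rpow hA0] at hlog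
  have h89 : Real.log (8 * 9) = Real.log 8 + Real.log 9 := Real.log_mul (by norm_num) (by norm_num)
  -- the entropy certificates
  have c6X := entropyCert_scaled (q := 6) (N₀ := 304) (u₀ := 38) (u₁ := 228) (u₂ := 38)
    (x := 228) 1 (by norm_num) (by norm_num) (by norm_num) (by norm_num) (by decide)
  have c6Y := entropyCert_scaled (q := 6) (N₀ := 304) (u₀ := 153) (u₁ := 150) (u₂ := 1)
    (x := 3478) 15 (by norm_num) (by norm_num) (by norm_num) (by norm_num) (by decide)
  have c7X := entropyCert_scaled (q := 7) (N₀ := 1422) (u₀ := 158) (u₁ := 1106) (u₂ := 158)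
    (x := 1106) 1 (by norm_num) (by norm_num) (by norm_num) (by norm_num) (by decide)
  have c7Y := entropyCert_scaled (q := 7) (N₀ := 1422) (u₀ := 714) (u₁ := 705) (u₂ := 3)
    (x := 5446) 5 (by norm_num) (by norm_num) (by norm_num) (by norm_num) (by decide)
  norm_num at c6X c6Y c7X c7Y hH1 hH2 hH3 hH1' hH2' hH3'
  have hX : Real.log 8 + Real.log 9 - 2 * Real.log A ≤
      Real.log 2 * (shannonEntropy (marginalDist₁ P) + shannonEntropy (marginalDist₁ P')) := by
    rw [hH1, hH1', mul_add, hLA]; linarith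
  have hY : Real.log 8 + Real.log 9 - 2 * Real.log A ≤
      Real.log 2 * (shannonEntropy (marginalDist₂ P) + shannonEntropy (marginalDist₂ P')) := by
    rw [hH2, hH2', mul_add, hLA]; linarith [log_six_thirteen_le]
  have hZ : Real.log 8 + Real.log 9 - 2 * Real.log A ≤
      Real.log 2 * (shannonEntropy (marginalDist₃ P) + shannonEntropy (marginalDist₃ P')) := by
    rw [hH3, hH3', mul_add, hLA]; linarith [log_six_thirteen_le]
  have hlog2 : 0 < Real.log 2 := Real.log_pos one_lt_two
  have hm : (Real.log 8 + Real.log 9 - 2 * Real.log A) / Real.log 2 ≤ m :=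
    le_min ((div_le_iff₀' hlog2).2 hX) (le_min ((div_le_iff₀' hlog2).2 hY)
      ((div_le_iff₀' hlog2).2 hZ))
  have hm' : Real.log 8 + Real.log 9 - 2 * Real.log A ≤ m * Real.log 2 :=
    (div_le_iff₀ hlog2).1 hm
  -- conclusion: `ω log A ≤ 2 log A`
  have e1 : omegaRect ℂ 1 ((27 : ℝ) / 92) 1 * Real.log A ≤
      Real.log 8 + Real.log 9 - m * Real.log 2 := by
    rw [h89] at hlog; linarith
  have e2 : Real.log 8 + Real.log 9 - m * Real.log 2 ≤ 2 * Real.log A := by linarith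
  have hfin : omegaRect ℂ 1 ((27 : ℝ) / 92) 1 * Real.log A ≤ 2 * Real.log A := e1.trans e2
  exact le_of_mul_le_mul_right hfin hlogA

/-- **`ω(1, 27/92, 1) = 2`.** [cite: Coppersmith1997, §3] -/
theorem omegaRect_one_27_92_one : omegaRect ℂ 1 ((27 : ℝ) / 92) 1 = 2 :=
  le_antisymm omegaRect_one_27_92_one_le_two (by
    have := add_le_omegaRect₁₃ ℂ 1 ((27 : ℝ) / 92) 1; linarith)

/-- **`α ≥ 27/92 = 0.29347…`** — the tree's proved dual exponent after gen 20, part 5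
(pooled `CW_6 ⊗ CW_7`, Coppersmith 1997's mechanism; was `77/267 = 0.28839`).
[cite: Coppersmith1997, §3] [cite: LeGall2012, §1] -/
theorem alpha_ge_27_92 : (27 : ℝ) / 92 ≤ dualExponentAlpha ℂ :=
  (omegaRect_eq_two_iff_le_dualExponentAlpha ℂ _).1 omegaRect_one_27_92_one

/-- `α > 0.29347`. [cite: Coppersmith1997, §3] -/
theorem dualExponentAlpha_gt_029347 : (0.29347 : ℝ) < dualExponentAlpha ℂ :=
  lt_of_lt_of_le (by norm_num) alpha_ge_27_92

/-- `ω(1, t, 1) = 2` for every `t ≤ 27/92`. [cite: Coppersmith1997, §3] -/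
theorem omegaRect_one_mid_one_eq_two' {t : ℝ} (ht : t ≤ 27 / 92) : omegaRect ℂ 1 t 1 = 2 :=
  (omegaRect_eq_two_iff_le_dualExponentAlpha ℂ t).2 (ht.trans alpha_ge_27_92)

end Summit.MatrixMultiplication.MatrixMultiplication.Theorems.SaturationLadderPooled
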